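import Literature.MathematicalPhysics.QuantumFieldTheory.Balaban1983to89.B5Prop12Entries110
import Literature.MathematicalPhysics.QuantumFieldTheory.Balaban1983to89.B5Blocks16

/-!
# Row G-an2-4 ∕ (CONV-C) — INTERFACE REQUEST G-an2-4 (B5-1115-TABLE): THE LOCALITY OF BAŁABAN's AVERAGING OPERATOR `Q_k` OF (1.18)
# IN SUP-NORM CURRENCY, and the block ∕ torus-distance bookkeeping it needs (supplier of `GAN24/Entry110LapReduction`)

NOT IN PRINT; OUR BOOKKEEPING.  Cell `pub-balaban`, G-an2-4 crux team (coordinator ruling e34b3e0c (2)), leaf seat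
`b2b-balaban-gan24-formalise-leaf-01` (gen 54), filed on the crux prover's «INTERFACE REQUEST G-an2-4: (B5-1115-TABLE)» (road-P2 owner
`b2b-balaban-gan24-p2` gen 28, `HOME/INBOX.md` 2026-08-21T05:44Z, journal `CLAIMS.log` l.27856) — the freeze's channel (ruling (0)); FILE 1 of 2 of
the (E4) reduction announced at journal l.28169; no Support leaf, no new object, no Literature fact, 0 `def`, 0 `def … : Prop`.

THE PRINTED OBJECT (T. Bałaban, *Propagators and renormalization transformations for lattice gauge theories. I*, Commun. Math. Phys. **95**
(1984) 17–40 = `Balaban1984PropagatorsI`, (1.18) p. 20): «(Q_kA)_b = Σ_{x∈B^k(b₋)} η^{d+1}A([x, x(b)]) … x(b) is a point in B^k(b₊) obtained from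
x by translation by b. If b = ⟨y, y + e_μ⟩, then x(b) = x + e_μ.» — typed as the matrix `B5Block118.QvOp n M` with `QvOp_mulVec`
(`(Q A)(y, μ) = η^{d+1} Σ_j Σ_{t<n} A(n·y + j + t e_μ, μ)`); its adjoint for the weighted scalar products is `B5DeltaA169.QvAdj = n^d • QvOpᴴ`.

WHAT IS PROVED (kernel, 0 sorry; every `d`, `n ≥ 1`, every torus `M`):
 * §1 `bpt_toT_add_tstep`: **a point of the straight contour of (1.18) from `B(z)` in direction `μ` lies in `B(z)` or in `B(z + e_μ)`**;
 * §2 torus sup-distance bookkeeping on `T₁ = Π_μ ℤ/M_μ` (`B4TorusKernel.MultiPeriod.torusSupNorm`): class invariance `torusSupNorm_congr_toT`,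
   `torusSupNorm_sub_eq_zero_of_toT_eq`, subadditivity, unit steps, and the «two neighbouring blocks» inequalities `torusSupNorm_sub_le_of_near` ∕
   `exp_le_of_near` (`|y − y′| ≤ |z − y′| + 1`, `|y − y′| ≤ |z + e_μ − y′| + 1` whenever `z̄ = ȳ` or `z̄ + e_μ = ȳ`);
 * §3 **`norm_QvOp_mulVec_le`**: if `|v| ≤ F(z)` blockwise then `|(Q_k v)(⟨z̄, z̄+e_μ⟩)| ≤ F(z) + F(z + e_μ)`; **`QvOp_apply_ne_zero`**: an entry
   `Q_k(b, (x, μ))`, `x ∈ B(ȳ)`, is non-zero only for `b = ⟨z̄, z̄+e_μ⟩` with `z̄ ∈ {ȳ, ȳ − e_μ}`; **`sum_norm_QvOp_apply_le`**: the column sums of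
   `|Q_k|` are `≤ η^d`; **`norm_QvOp_conjTranspose_mulVec_le`**: `|(Q_kᴴ w)(x, μ)| ≤ S·η^d` when `|w| ≤ S` on the two bonds through `x`.
HONEST SCOPE.  [folklore] lattice bookkeeping about the tree's literal (1.18) matrix; no estimate of any Bałaban propagator; consumed by
`GAN24/Entry110LapReduction` (the `a•Q*Q·G` term of `Δ·Δ_a⁻¹`).  NOT (CONV-C), NEVER «G-an2-4 closed», NOT NE2, NOT D1, NOT BetaPertH, NOT the
continuum limit, NOT Clay.  HONEST DEPENDENCY: continuum YM on T⁴ ⇐ BetaPertH ∧ nine spine estimates (0/9 proved); BetaPertH ⇐ (D1) ∧ (D4) ∧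
CAP+tail; G-an2-4 gates asym, D1 and NE2/3/4.
-/

noncomputable section

open scoped BigOperators Matrix ComplexConjugate
open Finset Complex Matrix

namespace Summit.QuantumFields.BalabanUV.Beta.GAN24.QvOpSupLocality

open Literature.MathematicalPhysics.QuantumFieldTheory.Balaban1983to89
open B5Prop11Plancherel (Tor fine)
open B5Block118 (bpt tstep lineSum QvOp QvOp_mulVec)
open B5Blocks16 (bpt_injective)
open B6LowerBound2153Torus (toT toT_add rep toT_rep)
open B6BondElimination (unitVec unitVec_apply)
open B4TorusKernel.MultiPeriod (torusSupNorm torusSupNorm_nonneg torusSupNorm_translate torusSupNorm_le_supNorm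
  translate circAbs)
open B4ContourShift (supNorm)
open B6Cov2156Torus (one_le_M)
open B5G183KernelDecay (bpt_toT)

variable {d : ℕ}

/-! ## §1 Block bookkeeping on the torus `T_η = Tor (fine n M)` over `T₁ = Tor M` -/

section Blocks

variable (n : ℕ) [NeZero n] (M : Fin d → ℕ) [hM : ∀ μ, NeZero (M μ)]

omit [NeZero n] hM in
/-- the contour step `t·e_μ` on the fine torus is the class of the integer vector `t·e_μ`. [folklore] -/
theorem tstep_eq_toT (μ : Fin d) (t : ℕ) :
    tstep (fine n M) μ t = toT (fine n M) (fun ν => if ν = μ then (t : ℤ) else 0) := by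
  funext ν
  by_cases h : ν = μ
  · simp [tstep, toT, h]
  · simp [tstep, toT, h]

omit [NeZero n] hM in
/-- **a point of the straight contour of `n` fine bonds from a site of `B(z)` in direction `μ` lies in `B(z)` or in
`B(z + e_μ)`** ((1.18): «x(b) is a point in B^k(b₊) obtained from x by translation by b»): for `0 ≤ t < n`,
`(n·z + j) + t·e_μ = n·z′ + j′` with `z′ ∈ {z, z + e_μ}`. [folklore] -/
theorem bpt_toT_add_tstep (z : Fin d → ℤ) (j : Fin d → Fin n) (μ : Fin d) (t : Fin n) :
    ∃ (z' : Fin d → ℤ) (j' : Fin d → Fin n),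
      bpt n M (toT M z) j + tstep (fine n M) μ t = bpt n M (toT M z') j' ∧ (z' = z ∨ z' = z + unitVec μ) := by
  by_cases h : (j μ : ℕ) + t < n
  · refine ⟨z, Function.update j μ ⟨j μ + t, h⟩, ?_, Or.inl rfl⟩
    rw [bpt_toT, bpt_toT, tstep_eq_toT, ← toT_add]
    congr 1
    funext ν
    by_cases hν : ν = μ
    · subst hν
      simp only [Pi.add_apply, Function.update_self, if_true]
      push_cast; ring
    · simp only [Pi.add_apply, Function.update_of_ne hν, if_neg hν, add_zero]
  · have h1 : (j μ : ℕ) + t - n < n := by have := (j μ).is_lt; have := t.is_lt; omega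
    refine ⟨z + unitVec μ, Function.update j μ ⟨j μ + t - n, h1⟩, ?_, Or.inr rfl⟩
    rw [bpt_toT, bpt_toT, tstep_eq_toT, ← toT_add]
    congr 1
    funext ν
    by_cases hν : ν = μ
    · subst hν
      have h2 : n ≤ (j ν : ℕ) + t := Nat.le_of_not_lt h
      simp only [Pi.add_apply, Function.update_self, if_true, unitVec_apply]
      rw [Nat.cast_sub h2]
      push_cast; ring
    · simp only [Pi.add_apply, Function.update_of_ne hν, if_neg hν, add_zero, unitVec_apply]

end Blocks

/-! ## §2 Torus-distance bookkeeping on `T₁ = Π_μ ℤ/M_μ` -/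

section Metric

variable (M : Fin (d + 1) → ℕ) [hM : ∀ μ, NeZero (M μ)]

omit hM in
/-- the torus sup-distance depends only on the class in `T₁`. [folklore] -/
theorem torusSupNorm_congr_toT {u v : Fin (d + 1) → ℤ} (h : toT M u = toT M v) :
    torusSupNorm M u = torusSupNorm M v := by
  have hc : ∀ i, ∃ m : ℤ, u i = v i + M i * m := by
    intro i
    have hi : (u i : ZMod (M i)) = (v i : ZMod (M i)) := congrFun h i
    rw [ZMod.intCast_eq_intCast_iff_dvd_sub] at hi
    obtain ⟨m, hm⟩ := hi
    exact ⟨-m, by linarith⟩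
  choose m hm using hc
  have hu : u = translate M v m := funext fun i => by rw [B4TorusKernel.MultiPeriod.translate_apply]; exact hm i
  rw [hu, torusSupNorm_translate]

omit hM in
/-- `|0|_{T₁} = 0`. [folklore] -/
theorem torusSupNorm_zero' : torusSupNorm M (0 : Fin (d + 1) → ℤ) = 0 := by
  unfold torusSupNorm
  have : (fun i : Fin (d + 1) => ((circAbs (M i) ((0 : Fin (d + 1) → ℤ) i) : ℤ) : ℝ)) = fun _ => 0 := by
    funext i
    rw [Pi.zero_apply, B4Sect5Torus.circAbs_zero, Int.cast_zero]
  rw [this, Finset.sup'_const]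

/-- subadditivity of the torus sup-distance. [folklore] -/
theorem torusSupNorm_add_le' (x y : Fin (d + 1) → ℤ) :
    torusSupNorm M (x + y) ≤ torusSupNorm M x + torusSupNorm M y := by
  unfold torusSupNorm
  refine Finset.sup'_le _ _ fun i _ => ?_
  have h : ((circAbs (M i) ((x + y) i) : ℤ) : ℝ) ≤ circAbs (M i) (x i) + circAbs (M i) (y i) := by
    rw [Pi.add_apply]
    exact_mod_cast B4Sect5Torus.circAbs_add_le (one_le_M M i) (x i) (y i)
  exact h.trans (add_le_add
    (Finset.le_sup' (fun j => ((circAbs (M j) (x j) : ℤ) : ℝ)) (Finset.mem_univ i))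
    (Finset.le_sup' (fun j => ((circAbs (M j) (y j) : ℤ) : ℝ)) (Finset.mem_univ i)))

/-- a unit step has torus length `≤ 1` (and so does its opposite). [folklore] -/
theorem torusSupNorm_smul_unitVec_le (μ : Fin (d + 1)) (s : ℤ) (hs : s = 1 ∨ s = -1) :
    torusSupNorm M (s • unitVec μ) ≤ 1 := by
  refine (torusSupNorm_le_supNorm (one_le_M M) _).trans ?_
  unfold supNorm
  refine Finset.sup'_le _ _ fun i _ => ?_
  rw [Pi.smul_apply, unitVec_apply, smul_eq_mul]
  rcases hs with h | h <;> subst h <;> by_cases hi : i = μ <;> simp [hi]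

omit hM in
/-- `toT` of a difference. [folklore] -/
theorem toT_sub' (u v : Fin (d + 1) → ℤ) : toT M u - toT M v = toT M (u - v) := by
  ext i; simp [toT]

omit hM in
/-- `toT 0 = 0`. [folklore] -/
theorem toT_zero' : toT M (0 : Fin (d + 1) → ℤ) = 0 := by
  ext i; simp [toT]

omit hM in
/-- congruent block labels are at torus distance `0`. [folklore] -/
theorem torusSupNorm_sub_eq_zero_of_toT_eq {y y' : Fin (d + 1) → ℤ} (h : toT M y = toT M y') :
    torusSupNorm M (y - y') = 0 := by
  rw [torusSupNorm_congr_toT M (u := y - y') (v := 0) (by rw [← toT_sub', h, sub_self, toT_zero']),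
    torusSupNorm_zero']

/-- **the two blocks a contour point can lie in are within torus distance `1` of each other**, in the form used
below: if `z̄ = ȳ` or `z̄ + e_μ = ȳ` in `T₁`, then `|y − y′|_{T₁} ≤ |z − y′|_{T₁} + 1` and
`|y − y′|_{T₁} ≤ |z + e_μ − y′|_{T₁} + 1`. [folklore] -/
theorem torusSupNorm_sub_le_of_near (z y y' : Fin (d + 1) → ℤ) (μ : Fin (d + 1))
    (h : toT M z = toT M y ∨ toT M (z + unitVec μ) = toT M y) :
    torusSupNorm M (y - y') ≤ torusSupNorm M (z - y') + 1
      ∧ torusSupNorm M (y - y') ≤ torusSupNorm M (z + unitVec μ - y') + 1 := by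
  have h0 := torusSupNorm_nonneg (one_le_M M) (z - y')
  have hp := torusSupNorm_smul_unitVec_le M μ 1 (Or.inl rfl)
  have hm := torusSupNorm_smul_unitVec_le M μ (-1) (Or.inr rfl)
  rw [one_smul] at hp
  rw [neg_one_smul] at hm
  rcases h with h | h
  · have e1 : torusSupNorm M (y - y') = torusSupNorm M (z - y') :=
      torusSupNorm_congr_toT M (by rw [← toT_sub', ← toT_sub', h])
    refine ⟨by linarith, ?_⟩
    have e2 : z - y' = (z + unitVec μ - y') + -unitVec μ := by abel
    rw [e1, e2]
    exact (torusSupNorm_add_le' M _ _).trans (by linarith)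
  · have e1 : torusSupNorm M (y - y') = torusSupNorm M (z + unitVec μ - y') :=
      torusSupNorm_congr_toT M (by rw [← toT_sub', ← toT_sub', h])
    refine ⟨?_, by linarith⟩
    have e2 : z + unitVec μ - y' = (z - y') + unitVec μ := by abel
    rw [e1, e2]
    exact (torusSupNorm_add_le' M _ _).trans (by linarith)

/-- the exponential form: under the same nearness, `e^{−δ|z − y′|}, e^{−δ|z + e_μ − y′|} ≤ e^{δ}·e^{−δ|y − y′|}`.
[folklore] -/
theorem exp_le_of_near {δ : ℝ} (hδ : 0 ≤ δ) (z y y' : Fin (d + 1) → ℤ) (μ : Fin (d + 1))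
    (h : toT M z = toT M y ∨ toT M (z + unitVec μ) = toT M y) :
    Real.exp (-(δ * torusSupNorm M (z - y'))) ≤ Real.exp δ * Real.exp (-(δ * torusSupNorm M (y - y')))
      ∧ Real.exp (-(δ * torusSupNorm M (z + unitVec μ - y')))
          ≤ Real.exp δ * Real.exp (-(δ * torusSupNorm M (y - y'))) := by
  obtain ⟨h1, h2⟩ := torusSupNorm_sub_le_of_near M z y y' μ h
  rw [← Real.exp_add]
  constructor
  · apply Real.exp_le_exp.mpr
    nlinarith [mul_le_mul_of_nonneg_left h1 hδ]
  · apply Real.exp_le_exp.mpr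
    nlinarith [mul_le_mul_of_nonneg_left h2 hδ]

end Metric


/-! ## §3 The locality of the averaging operator `Q_k` of (1.18) in sup-norm currency -/

section Averaging

variable (n : ℕ) [NeZero n] (M : Fin d → ℕ) [hM : ∀ μ, NeZero (M μ)]

/-- **`Q_k` reads a field on two blocks only**: if `|v| ≤ F(z)` on every block `B(z)`, then
`|(Q_k v)(⟨z̄, z̄+e_μ⟩)| ≤ F(z) + F(z + e_μ)` (the `n^{d+1}` contour points, each weighted `η^{d+1}`, lie in
`B(z) ∪ B(z + e_μ)`). [folklore] -/
theorem norm_QvOp_mulVec_le (v : Tor (fine n M) × Fin d → ℂ) (F : (Fin d → ℤ) → ℝ) (hF0 : ∀ z, 0 ≤ F z)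
    (hv : ∀ (z : Fin d → ℤ) (r : Fin d → Fin n) (μ' : Fin d), ‖v (bpt n M (toT M z) r, μ')‖ ≤ F z)
    (z : Fin d → ℤ) (μ : Fin d) :
    ‖(QvOp n M *ᵥ v) (toT M z, μ)‖ ≤ F z + F (z + unitVec μ) := by
  rw [QvOp_mulVec]
  have hn0 : (n : ℝ) ≠ 0 := by exact_mod_cast NeZero.ne n
  have hterm : ∀ (j : Fin d → Fin n) (t : Fin n),
      ‖v (bpt n M (toT M z) j + tstep (fine n M) μ t, μ)‖ ≤ F z + F (z + unitVec μ) := by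
    intro j t
    obtain ⟨z', j', he, hz'⟩ := bpt_toT_add_tstep n M z j μ t
    rw [he]
    rcases hz' with h | h <;> rw [h]
    · exact (hv z j' μ).trans (le_add_of_nonneg_right (hF0 _))
    · exact (hv _ j' μ).trans (le_add_of_nonneg_left (hF0 _))
  have hc : ‖(1 / (n : ℂ) ^ (d + 1))‖ = 1 / (n : ℝ) ^ (d + 1) := by simp [norm_pow]
  calc ‖1 / (n : ℂ) ^ (d + 1) * ∑ j, lineSum n M v (bpt n M (toT M z) j) μ‖
      ≤ (1 / (n : ℝ) ^ (d + 1)) * ∑ j : Fin d → Fin n, ∑ t : Fin n,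
          ‖v (bpt n M (toT M z) j + tstep (fine n M) μ t, μ)‖ := by
        rw [norm_mul, hc]
        refine mul_le_mul_of_nonneg_left ?_ (by positivity)
        refine (norm_sum_le _ _).trans (Finset.sum_le_sum fun j _ => ?_)
        exact norm_sum_le _ _
    _ ≤ (1 / (n : ℝ) ^ (d + 1)) * ∑ _j : Fin d → Fin n, ∑ _t : Fin n, (F z + F (z + unitVec μ)) := by
        gcongr with j _ t _
        exact hterm j t
    _ = F z + F (z + unitVec μ) := by
        simp only [Finset.sum_const, Finset.card_univ, Fintype.card_fin, Fintype.card_fun]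
        field_simp
        ring

/-- an entry `Q_k(b, (x, μ))` with `x ∈ B(ȳ)` can be non-zero only for the bond direction `μ` and for a bond starting in
the block `B(ȳ)` or in the block `B(ȳ − e_μ)`. [folklore] -/
theorem QvOp_apply_ne_zero (y : Fin d → ℤ) (r : Fin d → Fin n) (μ : Fin d) (z : Fin d → ℤ) (μ'' : Fin d)
    (h : QvOp n M (toT M z, μ'') (bpt n M (toT M y) r, μ) ≠ 0) :
    μ'' = μ ∧ (toT M z = toT M y ∨ toT M (z + unitVec μ) = toT M y) := by
  simp only [QvOp] at h
  by_cases hμ : μ = μ''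
  · subst hμ
    refine ⟨rfl, ?_⟩
    rw [if_pos rfl] at h
    obtain ⟨j, -, hj⟩ := Finset.exists_ne_zero_of_sum_ne_zero h
    obtain ⟨t, -, ht⟩ := Finset.exists_ne_zero_of_sum_ne_zero hj
    have hx : bpt n M (toT M y) r = bpt n M (toT M z) j + tstep (fine n M) μ t := by
      by_contra hne; exact ht (if_neg hne)
    obtain ⟨z', j', he, hz'⟩ := bpt_toT_add_tstep n M z j μ t
    rw [he] at hx
    have hinj := bpt_injective n M (a₁ := (toT M y, r)) (a₂ := (toT M z', j')) hx
    have hy : toT M z' = toT M y := (congrArg Prod.fst hinj).symm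
    rcases hz' with h' | h'
    · exact Or.inl (h' ▸ hy)
    · exact Or.inr (h' ▸ hy)
  · exact absurd (if_neg hμ) h

/-- the column sums of `|Q_k|`: every fine site is read with total weight `η^d = n·η^{d+1}` (one contour through it
per offset `t`). [folklore] -/
theorem sum_norm_QvOp_apply_le (x : Tor (fine n M)) (μ : Fin d) :
    ∑ b : Tor M × Fin d, ‖QvOp n M b (x, μ)‖ ≤ 1 / (n : ℝ) ^ d := by
  classical
  have hn0 : (n : ℝ) ≠ 0 := by exact_mod_cast NeZero.ne n
  have hc : ‖(1 / (n : ℂ) ^ (d + 1))‖ = 1 / (n : ℝ) ^ (d + 1) := by simp [norm_pow]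
  -- (a) only the bond direction `μ` contributes
  have ha : ∑ b : Tor M × Fin d, ‖QvOp n M b (x, μ)‖ = ∑ y'' : Tor M, ‖QvOp n M (y'', μ) (x, μ)‖ := by
    rw [Fintype.sum_prod_type]
    refine Finset.sum_congr rfl fun y'' _ => ?_
    rw [Finset.sum_eq_single μ]
    · intro μ'' _ hne
      simp [QvOp, Ne.symm hne]
    · intro h; exact absurd (Finset.mem_univ μ) h
  -- (b) the entry is a sum of `η^{d+1}`-weighted indicators
  have hb : ∀ y'' : Tor M, ‖QvOp n M (y'', μ) (x, μ)‖
      ≤ ∑ j : Fin d → Fin n, ∑ t : Fin n,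
          (if x = bpt n M y'' j + tstep (fine n M) μ t then 1 / (n : ℝ) ^ (d + 1) else 0) := by
    intro y''
    simp only [QvOp]
    refine (norm_sum_le _ _).trans (Finset.sum_le_sum fun j _ =>
      (norm_sum_le _ _).trans (Finset.sum_le_sum fun t _ => ?_))
    split_ifs
    · exact hc.le
    · rw [norm_zero]
  -- (d) for each offset `t` at most one (block, offset) pair hits `x`
  have hd : ∀ t : Fin n, ∑ y'' : Tor M, ∑ j : Fin d → Fin n,
      (if x = bpt n M y'' j + tstep (fine n M) μ t then 1 / (n : ℝ) ^ (d + 1) else 0)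
        ≤ 1 / (n : ℝ) ^ (d + 1) := by
    intro t
    have hprod : (∑ p : Tor M × (Fin d → Fin n),
        (if x = bpt n M p.1 p.2 + tstep (fine n M) μ t then 1 / (n : ℝ) ^ (d + 1) else (0 : ℝ)))
        = ∑ y'' : Tor M, ∑ j : Fin d → Fin n,
          (if x = bpt n M y'' j + tstep (fine n M) μ t then 1 / (n : ℝ) ^ (d + 1) else (0 : ℝ)) :=
      Fintype.sum_prod_type' (fun (y'' : Tor M) (j : Fin d → Fin n) =>
        (if x = bpt n M y'' j + tstep (fine n M) μ t then 1 / (n : ℝ) ^ (d + 1) else (0 : ℝ)))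
    rw [← hprod, Finset.sum_ite, Finset.sum_const_zero, add_zero, Finset.sum_const, nsmul_eq_mul]
    have hcard : (Finset.univ.filter fun p : Tor M × (Fin d → Fin n) =>
        x = bpt n M p.1 p.2 + tstep (fine n M) μ t).card ≤ 1 := by
      refine Finset.card_le_one.mpr fun p hp q hq => ?_
      rw [Finset.mem_filter] at hp hq
      exact bpt_injective n M (add_right_cancel (hp.2.symm.trans hq.2))
    have h0 : (0 : ℝ) ≤ 1 / (n : ℝ) ^ (d + 1) := by positivity
    calc ((Finset.univ.filter fun p : Tor M × (Fin d → Fin n) =>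
            x = bpt n M p.1 p.2 + tstep (fine n M) μ t).card : ℝ) * (1 / (n : ℝ) ^ (d + 1))
        ≤ 1 * (1 / (n : ℝ) ^ (d + 1)) := by
          refine mul_le_mul_of_nonneg_right ?_ h0
          exact_mod_cast hcard
      _ = _ := one_mul _
  rw [ha]
  calc ∑ y'' : Tor M, ‖QvOp n M (y'', μ) (x, μ)‖
      ≤ ∑ y'' : Tor M, ∑ j : Fin d → Fin n, ∑ t : Fin n,
          (if x = bpt n M y'' j + tstep (fine n M) μ t then 1 / (n : ℝ) ^ (d + 1) else 0) :=
        Finset.sum_le_sum fun y'' _ => hb y''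
    _ = ∑ y'' : Tor M, ∑ t : Fin n, ∑ j : Fin d → Fin n,
          (if x = bpt n M y'' j + tstep (fine n M) μ t then 1 / (n : ℝ) ^ (d + 1) else 0) :=
        Finset.sum_congr rfl fun y'' _ => Finset.sum_comm
    _ = ∑ t : Fin n, ∑ y'' : Tor M, ∑ j : Fin d → Fin n,
          (if x = bpt n M y'' j + tstep (fine n M) μ t then 1 / (n : ℝ) ^ (d + 1) else 0) :=
        Finset.sum_comm
    _ ≤ ∑ _t : Fin n, 1 / (n : ℝ) ^ (d + 1) := Finset.sum_le_sum fun t _ => hd t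
    _ = 1 / (n : ℝ) ^ d := by
        rw [Finset.sum_const, Finset.card_univ, Fintype.card_fin, nsmul_eq_mul]
        field_simp
        ring

/-- **`Q_kᴴ` re-reads a bond field on the two bonds through a site, with total weight `η^d`**: if `|w| ≤ S` on the
bonds `⟨z̄, z̄+e_μ⟩` with `z̄ ∈ {ȳ, ȳ − e_μ}`, then `|(Q_kᴴ w)(x, μ)| ≤ S·n^{−d}` for `x ∈ B(ȳ)`. [folklore] -/
theorem norm_QvOp_conjTranspose_mulVec_le (w : Tor M × Fin d → ℂ) (y : Fin d → ℤ) (r : Fin d → Fin n)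
    (μ : Fin d) {S : ℝ} (hS : 0 ≤ S)
    (hw : ∀ z : Fin d → ℤ, (toT M z = toT M y ∨ toT M (z + unitVec μ) = toT M y) → ‖w (toT M z, μ)‖ ≤ S) :
    ‖((QvOp n M)ᴴ *ᵥ w) (bpt n M (toT M y) r, μ)‖ ≤ S / (n : ℝ) ^ d := by
  set x := bpt n M (toT M y) r with hx
  have hterm : ∀ b : Tor M × Fin d, ‖(QvOp n M)ᴴ (x, μ) b * w b‖ ≤ ‖QvOp n M b (x, μ)‖ * S := by
    intro b
    rw [norm_mul, Matrix.conjTranspose_apply, norm_star]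
    by_cases hb : QvOp n M b (x, μ) = 0
    · rw [hb, norm_zero, zero_mul, zero_mul]
    · refine mul_le_mul_of_nonneg_left ?_ (norm_nonneg _)
      have hb' : QvOp n M (toT M (rep M b.1), b.2) (bpt n M (toT M y) r, μ) ≠ 0 := by rwa [toT_rep]
      obtain ⟨hμ, hnear⟩ := QvOp_apply_ne_zero n M y r μ (rep M b.1) b.2 hb'
      have hb2 : b = (toT M (rep M b.1), μ) := by rw [toT_rep]; exact Prod.ext rfl hμ
      rw [hb2]
      exact hw _ hnear
  calc ‖((QvOp n M)ᴴ *ᵥ w) (x, μ)‖ = ‖∑ b, (QvOp n M)ᴴ (x, μ) b * w b‖ := rfl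
    _ ≤ ∑ b, ‖QvOp n M b (x, μ)‖ * S := (norm_sum_le _ _).trans (Finset.sum_le_sum fun b _ => hterm b)
    _ = (∑ b, ‖QvOp n M b (x, μ)‖) * S := by rw [Finset.sum_mul]
    _ ≤ 1 / (n : ℝ) ^ d * S := mul_le_mul_of_nonneg_right (sum_norm_QvOp_apply_le n M x μ) hS
    _ = S / (n : ℝ) ^ d := by ring

end Averaging

end Summit.QuantumFields.BalabanUV.Beta.GAN24.QvOpSupLocality

end
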